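import Summits.Ventures.HSemireg.Mod4IdealShapeDet

/-!
# Venture HSemireg — MOD-4 line: the `I_Z`-SHAPE h-parts at EVERY `O_Z` pin of an even `n` — `det(T_f(q) − μ_a) =
# (−1)ⁿ q_0 · det TL_a · det B_a · det BR_a`: the pin value `μ_a` survives as an eigenvalue of `T_f` exactly on three hypersurfaces

HONEST FRAMING. Part of the Lean index of the computation cell `pub-hsemireg` (seat w3-mod4-1 gen 15, W3 SPECIAL FIBRES; file of
record `HOME/widen/W3/MOD4-OFFSPLIT-w3mod4.md` §13.33 (exploratory claim, machine 60∕60) and §13.38). `Mod4IdealShapePinZero` ∕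
`Mod4IdealShapeDet` treated the extreme pin `a = 0`; here the inner pins. ELEMENTARY LINEAR ALGEBRA over a field ONLY: no abelian
variety, no sheaf, no Ext group, no semiregularity map; nothing here says that HC / HC_CM / HC_AV holds; no Literature fact is
declared; NO definition is introduced.

SETTING: `n = a + k + a` even, `I_Z` shape (`q_m = 0` for `1 ≤ m < n`; `q_0`, `q_n`, tail arbitrary), `q⁰ = q[0 ↦ 0]`, `μ_a = (−1)^a C(n,a) q_n`,
`N = T_f(q⁰) − μ_a` (upper triangular, zero pivots at `a` and `a + k`). The `n × n` Hessenberg matrix `Ñ = (N_{r, s+1})_{r,s<n}` of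
`Mod4IdealShapeDet` is block upper triangular for the partition `[0,a) ∪ [a,a+k) ∪ [a+k,n)` with diagonal blocks
`TL_a = (N_{i, 1+j})_{i,j<a}`, `B_a = (N_{a+r, a+1+s})_{r,s<k}` (the pin block of `Mod4LeadingTermPinCriterion`) and
`BR_a = (N_{a+k+i, a+k+1+j})_{i,j<a}` — all three hypothesis-bound `Matrix.of`, no definition. WHAT IS PROVED:
* **`det_of_lowerLeft_eq_zero`** — general: `M : Matrix (Fin m) (Fin m)`, `m = p + q`, with `M i j = 0` for `j < p ≤ i` has
  `det M = det(top-left p × p) · det(bottom-right q × q)` (`finSumFinEquiv` + `Matrix.det_fromBlocks_zero₂₁`);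
* **`det_hankelT_leading_sub_pin_eq_zero`** — `det N = 0` (`a ≤ n`; triangular with a zero pivot);
* **`det_hessenberg_pin_eq`** — `det Ñ = det TL_a · det B_a · det BR_a` (even `n`: the sub-diagonal of `Ñ` vanishes at `a` and `a + k`);
* **`det_hankelT_idealShape_sub_pin`** — `det(T_f(q) − μ_a) = (−1)ⁿ q_0 · (det TL_a · det B_a · det BR_a)`;
* **`ker_hankelT_idealShape_sub_pin_ne_bot_iff`** — for `q_0 ≠ 0`: `ker(T_f(q) − μ_a) ≠ ⊥ ↔ det TL_a · det B_a · det BR_a = 0`.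
READING: at an inner `O_Z` pin `t_a` of an even `n` the `I_Z` row keeps the eigenvalue `μ_a` of `T_f` exactly on the union of three
hypersurfaces — the `O_Z` drop-2 hypersurface `det B_a = 0` of §13.31 and two new ones `det TL_a = 0`, `det BR_a = 0` in the tail
(machine, §13.33: 60∕60 even-`n` cases); `a = 0` is `Mod4IdealShapeDet` (`TL`, `BR` empty). The multiplicity and the `−μ_a` half are
not treated here. Everything PROVED, 0 sorry. Namespace `Summit.Ventures.HSemireg.Mod4`. References: [BourbakiAlgebre1a3] Ch. III §8;
[BuchweitzFlenner2008HH] Prop. 6.4.4 (why these matrices).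
-/

namespace Summit.Ventures.HSemireg.Mod4

open Finset Matrix

variable {K : Type*} [Field K]

/-- **block lower-left zero ⇒ the determinant factors:** for `M : Matrix (Fin m) (Fin m)`, `m = p + q`, with `M i j = 0`
whenever `j < p ≤ i`: `det M = det (M_{ij})_{i,j<p} · det (M_{p+i,p+j})_{i,j<q}` (`finSumFinEquiv` + `Matrix.det_fromBlocks_zero₂₁`).
[cite: BourbakiAlgebre1a3, Ch. III §8] -/
theorem det_of_lowerLeft_eq_zero {m p q : ℕ} (hm : m = p + q) (M : Matrix (Fin m) (Fin m) K)
    (hM : ∀ i j : Fin m, (j : ℕ) < p → p ≤ (i : ℕ) → M i j = 0)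
    {A : Matrix (Fin p) (Fin p) K} (hA : A = Matrix.of fun i j : Fin p => M ⟨i, by omega⟩ ⟨j, by omega⟩)
    {D : Matrix (Fin q) (Fin q) K} (hD : D = Matrix.of fun i j : Fin q => M ⟨p + i, by omega⟩ ⟨p + j, by omega⟩) :
    M.det = A.det * D.det := by
  subst hm
  rw [← Matrix.det_reindex_self finSumFinEquiv.symm M]
  have hre : Matrix.reindex finSumFinEquiv.symm finSumFinEquiv.symm M =
      Matrix.fromBlocks A (Matrix.of fun (i : Fin p) (j : Fin q) => M (Fin.castAdd q i) (Fin.natAdd p j)) 0 D := by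
    ext x y
    rw [Matrix.reindex_apply, Equiv.symm_symm, Matrix.submatrix_apply]
    rcases x with i | i <;> rcases y with j | j
    · rw [Matrix.fromBlocks_apply₁₁, finSumFinEquiv_apply_left, finSumFinEquiv_apply_left, hA, Matrix.of_apply]
      rfl
    · rw [Matrix.fromBlocks_apply₁₂, finSumFinEquiv_apply_left, finSumFinEquiv_apply_right, Matrix.of_apply]
    · rw [Matrix.fromBlocks_apply₂₁, finSumFinEquiv_apply_right, finSumFinEquiv_apply_left, Matrix.zero_apply]
      exact hM _ _ (by simp) (by simp)
    · rw [Matrix.fromBlocks_apply₂₂, finSumFinEquiv_apply_right, finSumFinEquiv_apply_right, hD, Matrix.of_apply]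
      rfl
  rw [hre, Matrix.det_fromBlocks_zero₂₁]

/-- **`det (T_f(q⁰) − μ_a) = 0`** for a leading shape `q⁰` (`q⁰_m = 0`, `m < n`) and `a ≤ n`: triangular with the zero pivot `b = a`.
[cite: BourbakiAlgebre1a3, Ch. III §8] -/
theorem det_hankelT_leading_sub_pin_eq_zero {n : ℕ} {q : ℕ → K} (hq0 : ∀ m, m < n → q m = 0) {a : ℕ} (ha : a ≤ n) {μ : K}
    (hμ : μ = (-1 : K) ^ a * (n.choose a : K) * q n) :
    (hankelT n q - μ • (1 : Matrix (Fin (n + 1)) (Fin (n + 1)) K)).det = 0 := by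
  rw [Matrix.det_of_upperTriangular (blockTriangular_hankelT_leading_sub hq0 μ)]
  refine Finset.prod_eq_zero (Finset.mem_univ (⟨a, by omega⟩ : Fin (n + 1))) ?_
  rw [Matrix.sub_apply, Matrix.smul_apply, Matrix.one_apply_eq, smul_eq_mul, mul_one, hankelT_apply,
    show n - ((⟨a, by omega⟩ : Fin (n + 1)) : ℕ) + ((⟨a, by omega⟩ : Fin (n + 1)) : ℕ) = n by simp only; omega, hμ]
  exact sub_self _

/-- **the Hessenberg matrix `Ñ = (N_{r,s+1})` of `N = T_f(q⁰) − μ_a` factors through its three diagonal blocks** for `n = a + k + a`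
even and a leading shape `q⁰`: `det Ñ = det TL_a · det B_a · det BR_a` (the sub-diagonal entries of `Ñ` at `a` and `a + k` are the two
zero pivots of `N`). [cite: BourbakiAlgebre1a3, Ch. III §8] -/
theorem det_hessenberg_pin_eq [CharZero K] {n a k : ℕ} (hn : n = a + k + a) (heven : Even n) {q : ℕ → K}
    (hq0 : ∀ m, m < n → q m = 0) (hqn : q n ≠ 0) {μ : K} (hμ : μ = (-1 : K) ^ a * (n.choose a : K) * q n)
    {NN : Matrix (Fin n) (Fin n) K}
    (hNN : NN = Matrix.of fun r s : Fin n =>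
      (hankelT n q - μ • (1 : Matrix (Fin (n + 1)) (Fin (n + 1)) K)) (Fin.castSucc r) (Fin.succ s))
    {TL : Matrix (Fin a) (Fin a) K}
    (hTL : TL = Matrix.of fun i j : Fin a =>
      (hankelT n q - μ • (1 : Matrix (Fin (n + 1)) (Fin (n + 1)) K)) ⟨i, by omega⟩ ⟨j + 1, by omega⟩)
    {B : Matrix (Fin k) (Fin k) K}
    (hB : B = Matrix.of fun r s : Fin k =>
      (hankelT n q - μ • (1 : Matrix (Fin (n + 1)) (Fin (n + 1)) K)) ⟨a + r, by omega⟩ ⟨a + 1 + s, by omega⟩)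
    {BR : Matrix (Fin a) (Fin a) K}
    (hBR : BR = Matrix.of fun i j : Fin a =>
      (hankelT n q - μ • (1 : Matrix (Fin (n + 1)) (Fin (n + 1)) K)) ⟨a + k + i, by omega⟩ ⟨a + k + 1 + j, by omega⟩) :
    NN.det = TL.det * B.det * BR.det := by
  subst hn
  set N := hankelT (a + k + a) q - μ • (1 : Matrix (Fin (a + k + a + 1)) (Fin (a + k + a + 1)) K) with hN
  obtain ⟨hNa, hNak, -⟩ := hankelT_sub_pin_diag (show a + k + a = a + k + a from rfl) heven hqn hμ
  rw [← hN] at hNa hNak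
  have htri : N.BlockTriangular id := blockTriangular_hankelT_leading_sub hq0 μ
  -- the Hessenberg zero pattern of `NN`, including the two zero sub-diagonal entries
  have hNNz : ∀ r s : Fin (a + k + a), (s : ℕ) + 1 < (r : ℕ) ∨ ((s : ℕ) + 1 = (r : ℕ) ∧ ((r : ℕ) = a ∨ (r : ℕ) = a + k)) →
      NN r s = 0 := by
    intro r s h
    rw [hNN, Matrix.of_apply]
    rcases h with h | ⟨h1, h2⟩
    · exact htri (show (Fin.succ s) < Fin.castSucc r from by
        rw [Fin.lt_def, Fin.val_succ, Fin.val_castSucc]; exact h)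
    · have hrs : Fin.succ s = Fin.castSucc r := Fin.ext (by rw [Fin.val_succ, Fin.val_castSucc]; exact h1)
      rw [hrs]
      rcases h2 with h2 | h2
      · have : Fin.castSucc r = ⟨a, by omega⟩ := Fin.ext (by rw [Fin.val_castSucc]; exact h2)
        rw [this]; exact hNa
      · have : Fin.castSucc r = ⟨a + k, by omega⟩ := Fin.ext (by rw [Fin.val_castSucc]; exact h2)
        rw [this]; exact hNak
  -- first split `[0, a) | [a, a + k + a)`, then the bottom-right `(k + a) × (k + a)` block splits as `[0, k) | [k, k + a)`
  let M₂ : Matrix (Fin (k + a)) (Fin (k + a)) K := Matrix.of fun i j => NN ⟨a + i, by omega⟩ ⟨a + j, by omega⟩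
  have h1 : NN.det = TL.det * M₂.det := by
    refine det_of_lowerLeft_eq_zero (show a + k + a = a + (k + a) by omega) NN (fun i j hj hi => ?_) ?_ rfl
    · exact hNNz _ _ (by omega)
    · rw [hTL]; ext i j
      rw [Matrix.of_apply, Matrix.of_apply, hNN, Matrix.of_apply]
      congr 1
  have h2 : M₂.det = B.det * BR.det := by
    refine det_of_lowerLeft_eq_zero (show k + a = k + a from rfl) M₂ (fun i j hj hi => ?_) ?_ ?_
    · simp only [M₂, Matrix.of_apply]
      exact hNNz _ _ (by simp only; omega)
    · rw [hB]; ext r s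
      simp only [M₂, Matrix.of_apply, hNN]
      congr 1; exact Fin.ext (by simp; omega)
    · rw [hBR]; ext i j
      simp only [M₂, Matrix.of_apply, hNN]
      congr 1 <;> exact Fin.ext (by simp; omega)
  rw [h1, h2, mul_assoc]

/-- **THE I_Z DETERMINANT AT EVERY O_Z PIN (even `n`):** for an `I_Z` shape (`q_m = 0`, `1 ≤ m < n`), `n = a + k + a` even, `q_n ≠ 0`,
`μ_a = (−1)^a C(n,a) q_n`: `det(T_f(q) − μ_a) = (−1)ⁿ q_0 · (det TL_a · det B_a · det BR_a)`, the blocks taken from `N = T_f(q⁰) − μ_a`.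
[cite: BourbakiAlgebre1a3, Ch. III §8] -/
theorem det_hankelT_idealShape_sub_pin [CharZero K] {n a k : ℕ} (hn : n = a + k + a) (heven : Even n) (hn1 : 1 ≤ n)
    {q : ℕ → K} (hq : ∀ m, 1 ≤ m → m < n → q m = 0) (hqn : q n ≠ 0) {μ : K} (hμ : μ = (-1 : K) ^ a * (n.choose a : K) * q n)
    {TL : Matrix (Fin a) (Fin a) K}
    (hTL : TL = Matrix.of fun i j : Fin a =>
      (hankelT n (Function.update q 0 0) - μ • (1 : Matrix (Fin (n + 1)) (Fin (n + 1)) K)) ⟨i, by omega⟩ ⟨j + 1, by omega⟩)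
    {B : Matrix (Fin k) (Fin k) K}
    (hB : B = Matrix.of fun r s : Fin k =>
      (hankelT n (Function.update q 0 0) - μ • (1 : Matrix (Fin (n + 1)) (Fin (n + 1)) K)) ⟨a + r, by omega⟩
        ⟨a + 1 + s, by omega⟩)
    {BR : Matrix (Fin a) (Fin a) K}
    (hBR : BR = Matrix.of fun i j : Fin a =>
      (hankelT n (Function.update q 0 0) - μ • (1 : Matrix (Fin (n + 1)) (Fin (n + 1)) K)) ⟨a + k + i, by omega⟩
        ⟨a + k + 1 + j, by omega⟩) :
    (hankelT n q - μ • (1 : Matrix (Fin (n + 1)) (Fin (n + 1)) K)).det = (-1 : K) ^ n * q 0 * (TL.det * B.det * BR.det) := by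
  obtain ⟨hq0', hqn'⟩ := idealShape_update_zero hn1 hq
  have hμ' : μ = (-1 : K) ^ a * (n.choose a : K) * Function.update q 0 (0 : K) n := by rw [hqn']; exact hμ
  rw [det_hankelT_idealShape_sub n q μ rfl, det_hankelT_leading_sub_pin_eq_zero hq0' (by omega) hμ', zero_add,
    det_hessenberg_pin_eq hn heven hq0' (by rw [hqn']; exact hqn) hμ' rfl hTL hB hBR]

/-- **`μ_a` is an eigenvalue of `T_f(q)` iff one of the three blocks is singular** (`I_Z` shape, even `n = a + k + a`, `q_0 ≠ 0`,
`q_n ≠ 0`): `ker(T_f(q) − μ_a) ≠ ⊥ ↔ det TL_a · det B_a · det BR_a = 0`. [cite: BourbakiAlgebre1a3, Ch. III §8]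
[cite: BuchweitzFlenner2008HH, Prop. 6.4.4] -/
theorem ker_hankelT_idealShape_sub_pin_ne_bot_iff [CharZero K] {n a k : ℕ} (hn : n = a + k + a) (heven : Even n) (hn1 : 1 ≤ n)
    {q : ℕ → K} (hq : ∀ m, 1 ≤ m → m < n → q m = 0) (hq0 : q 0 ≠ 0) (hqn : q n ≠ 0) {μ : K}
    (hμ : μ = (-1 : K) ^ a * (n.choose a : K) * q n) {TL : Matrix (Fin a) (Fin a) K}
    (hTL : TL = Matrix.of fun i j : Fin a =>
      (hankelT n (Function.update q 0 0) - μ • (1 : Matrix (Fin (n + 1)) (Fin (n + 1)) K)) ⟨i, by omega⟩ ⟨j + 1, by omega⟩)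
    {B : Matrix (Fin k) (Fin k) K}
    (hB : B = Matrix.of fun r s : Fin k =>
      (hankelT n (Function.update q 0 0) - μ • (1 : Matrix (Fin (n + 1)) (Fin (n + 1)) K)) ⟨a + r, by omega⟩
        ⟨a + 1 + s, by omega⟩)
    {BR : Matrix (Fin a) (Fin a) K}
    (hBR : BR = Matrix.of fun i j : Fin a =>
      (hankelT n (Function.update q 0 0) - μ • (1 : Matrix (Fin (n + 1)) (Fin (n + 1)) K)) ⟨a + k + i, by omega⟩
        ⟨a + k + 1 + j, by omega⟩) :
    LinearMap.ker (Matrix.toLin' (hankelT n q) - μ • LinearMap.id) ≠ ⊥ ↔ TL.det * B.det * BR.det = 0 := by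
  rw [toLin'_sub_smul_id, ne_eq, Matrix.ker_toLin'_eq_bot_iff]
  have hdet := det_hankelT_idealShape_sub_pin hn heven hn1 hq hqn hμ hTL hB hBR
  have hc : (-1 : K) ^ n * q 0 ≠ 0 := mul_ne_zero (pow_ne_zero _ (neg_ne_zero.mpr one_ne_zero)) hq0
  constructor
  · intro h
    by_contra hne
    apply h
    intro v hv
    exact Matrix.eq_zero_of_mulVec_eq_zero (by rw [hdet]; exact mul_ne_zero hc hne) hv
  · intro h hall
    obtain ⟨v, hv0, hv⟩ := Matrix.exists_mulVec_eq_zero_iff.mpr (show (hankelT n q - μ • (1 : Matrix (Fin (n + 1)) (Fin (n + 1)) K)).det = 0 by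
      rw [hdet, h, mul_zero])
    exact hv0 (hall v hv)

end Summit.Ventures.HSemireg.Mod4
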